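import Summits.QuantumFields.BalabanUV.T4Continuum.Spine.NE2.ComposedRemainderTwoLevel
import Summits.QuantumFields.BalabanUV.T4Continuum.Spine.NE2.ComposedAveragingMean

/-!
# T⁴ programme, spine node NE2 (U1a) — R14 W3d: THE REAL RATE ARITHMETIC OF THE COMPOSED REMAINDER `E″` DISCHARGED FOR PRINT's LETTER SHAPES
# (cell `pub-balaban-gaps`, seat ne2 gen 7; plan `run/shared/lean/pub/pub-balaban-gaps/ne/NE2-R14-PLAN.md` STATUS v6 «the `hrate`/`hΓ`/`hE` real inequalities stay displayed»)

The ENDs `ComposedRemainderTwoLevel.composed_full_averaging_rate_of_letters` (gen 5), `ComposedRemainderLoopRate.composed_full_averaging_rate_of_loops` (gen 6, file 4) and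
`ComposedRemainderGaugeTower.composed_full_averaging_rate_of_gaugeTowers` (gen 6, file 7) display, next to the data letters, THREE REAL INEQUALITIES on those letters:
`hΓ` (the sum of the one-step coefficient letters `γ_{k,i} = 64·d·L²·p_{k,i+1}` is `≤ Γ`), `hE` (the sum of the primed step sizes `card o·σ_{k,i} + c_R·γ_{k,i}` is `≤ E`) and `hrate`
(`sameBnd + crossBnd ≤ C_r·ρ^k`, the same-data and cross bounds of `same_data_pair_le` / `cross_pair_le` as functions of the letters).  In print these are the geometric-series
arithmetic of [B7] (143) p. 39: `σ_k^{top} = O(αL^{−k})`, `γ_k^{top} = O(L²α₀L^{−2k})`, cross letters `O(θ_c^k)`.  THIS FILE proves them for PRINT's LETTER SHAPES — sizes `α_U/L^i`,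
plaquette letters dominated by `p_U/L^{2i}`, NE3-type closeness `consC L σ_U θ_c k i = σ_Uθ_c^k/L^i` (`i ≤ k`; the trivial `2` beyond) — with CLOSED-FORM constants:
 * §1 real bookkeeping: `(1 + c)^q − 1 ≤ q·c·e^{qc₀}` (`deltaS_le`), `Π_{i<k}(1 + x_i) ≤ e^{Σx_i}`, geometric sums at ratio `L⁻¹ ≤ ½` and `L⁻² ≤ ½`;
 * §2 **`sum_gamma_le`** (`hΓ` with `Γ := GamU d p_U = 128·d·p_U`) and **`sum_eps_le`** (`hE` with `E := EU = card o·q·2α_U·e^{2qα_U} + c_R·128·d·p_U`, `q = (d+1)L`);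
 * §3 **`rate_le`**: `sameBnd + crossBnd ≤ CrU·ρ^k` for every `ρ ≥ max(θ_c, 3/(2L))`, in EXACTLY the letter-expanded form displayed by file 7's END (so that file 7's `hΓ`, `hE`, `hrate`
   are discharged by `sum_gamma_le`, `sum_eps_le`, `rate_le` — the assembled END is `ComposedRemainderGaugeTowerGeometric`, filed after file 7).
HONEST FRAMING (T4-DAG p. 1).  Elementary real inequalities about the TREE's MODEL constants; nothing of Bałaban's asserted; NOT NE2, NOT [B7] (143) as printed; **NE2 (U1a) NOT PROVED**;
spine PROVED 0/9 unchanged; NOT continuum YM / infinite volume / mass gap / Clay.  No `sorry`.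
-/

noncomputable section

open scoped BigOperators
open Finset (range)

namespace Summit.QuantumFields.BalabanUV.T4Continuum.NE2.ComposedRemainderRateLetters

open Literature.MathematicalPhysics.QuantumFieldTheory.Balaban1983to89.B5Prop11Plancherel (Cst Cst_nonneg)
open Literature.MathematicalPhysics.QuantumFieldTheory.Balaban1983to89.B5G183RateUnitTower (lev)
open Literature.MathematicalPhysics.QuantumFieldTheory.Balaban1983to89.T4AxialChain (one_add_pow_le_exp)
open Literature.MathematicalPhysics.QuantumFieldTheory.Balaban1983to89.B9Eq373V3 (exp_sub_one_le_mul_exp_of_le)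
open Summit.QuantumFields.BalabanUV.T4Continuum.BalabanAveragedTowerUnit (cast_lev')
open Summit.QuantumFields.BalabanUV.T4Continuum.NE2.CovariantTableBalabanTwoLevel (consBal consBal_nonneg)
open Summit.QuantumFields.BalabanUV.T4Continuum.NE2.ComposedAveragingMean (consC consC_nonneg consBal_le geom_sum_le_two inv_le_half)
open Summit.QuantumFields.BalabanUV.T4Continuum.NE2.ComposedRemainderTower (cR cR_nonneg)
open Summit.QuantumFields.BalabanUV.T4Continuum.NE2.ComposedRemainderTwoLevel (deltaS epsStep DeltaStep sameBnd crossBnd)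

variable {d : ℕ} {L : ℕ}

/-! ## §1 Real bookkeeping -/

/-- `(1 + c)^q − 1 ≤ q·c·e^{q·c₀}` for `0 ≤ c ≤ c₀`. [folklore] -/
theorem deltaS_le {c c₀ : ℝ} (hc : 0 ≤ c) (hc₀ : c ≤ c₀) :
    deltaS d L c ≤ (((d + 1) * L : ℕ) : ℝ) * c * Real.exp ((((d + 1) * L : ℕ) : ℝ) * c₀) := by
  unfold deltaS
  set q : ℕ := (d + 1) * L
  have hq : (0 : ℝ) ≤ q := Nat.cast_nonneg q
  calc (1 + c) ^ q - 1 ≤ Real.exp (q * c) - 1 := by linarith [one_add_pow_le_exp hc q]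
    _ ≤ (q * c) * Real.exp (q * c₀) := exp_sub_one_le_mul_exp_of_le (by positivity) (mul_le_mul_of_nonneg_left hc₀ hq)
    _ = _ := by ring

/-- `0 ≤ deltaS` for `0 ≤ c`. [folklore] -/
theorem deltaS_nonneg {c : ℝ} (hc : 0 ≤ c) : 0 ≤ deltaS d L c := by
  unfold deltaS; exact sub_nonneg.mpr (one_le_pow₀ (by linarith))

/-- `Π_{i<k}(1 + x_i) ≤ exp(Σ_{i<k} x_i)` for `x ≥ 0`. [folklore] -/
theorem prod_one_add_le_exp_sum (x : ℕ → ℝ) (hx : ∀ i, 0 ≤ x i) (k : ℕ) :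
    ∏ i ∈ range k, (1 + x i) ≤ Real.exp (∑ i ∈ range k, x i) := by
  rw [Real.exp_sum]
  exact Finset.prod_le_prod (fun i _ => by linarith [hx i]) fun i _ => by linarith [Real.add_one_le_exp (x i)]

/-- `Σ_{i<k} (L⁻¹)^i ≤ 2` (`L ≥ 2`). [folklore] -/
theorem sum_invPow_le_two (hL : 2 ≤ L) (k : ℕ) : ∑ i ∈ range k, ((L : ℝ)⁻¹) ^ i ≤ 2 := by
  obtain ⟨h0, h2⟩ := inv_le_half hL
  linarith [geom_sum_le_two h0 h2 k, pow_nonneg h0 k]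

/-- `Σ_{i<k} (L⁻¹)^{i+1} ≤ 1` (`L ≥ 2`). [folklore] -/
theorem sum_invPow_succ_le_one (hL : 2 ≤ L) (k : ℕ) : ∑ i ∈ range k, ((L : ℝ)⁻¹) ^ (i + 1) ≤ 1 := by
  obtain ⟨h0, h2⟩ := inv_le_half hL
  have e : ∑ i ∈ range k, ((L : ℝ)⁻¹) ^ (i + 1) = (L : ℝ)⁻¹ * ∑ i ∈ range k, ((L : ℝ)⁻¹) ^ i := by
    rw [Finset.mul_sum]; exact Finset.sum_congr rfl fun i _ => by rw [pow_succ]; ring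
  rw [e]
  nlinarith [geom_sum_le_two h0 h2 k, pow_nonneg h0 k]

/-- `Σ_{i<k} ((L⁻¹)²)^i ≤ 2` (`L ≥ 2`). [folklore] -/
theorem sum_invSq_le_two (hL : 2 ≤ L) (k : ℕ) : ∑ i ∈ range k, (((L : ℝ)⁻¹) ^ 2) ^ i ≤ 2 := by
  obtain ⟨h0, h2⟩ := inv_le_half hL
  have hx0 : 0 ≤ ((L : ℝ)⁻¹) ^ 2 := pow_nonneg h0 2
  have hx : ((L : ℝ)⁻¹) ^ 2 ≤ 1 / 2 := by nlinarith
  linarith [geom_sum_le_two hx0 hx k, pow_nonneg hx0 k]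

/-- `1/n_k = (L⁻¹)^k`. [folklore] -/
theorem inv_lev_eq (k : ℕ) : ((lev L k : ℕ) : ℝ)⁻¹ = ((L : ℝ)⁻¹) ^ k := by rw [cast_lev', inv_pow]

/-- `(L⁻¹)^k ≤ ρ^k` whenever `3/(2L) ≤ ρ`. [folklore] -/
theorem invPow_le_rhoPow (hL : 1 ≤ L) {ρ : ℝ} (hρ : 3 / (2 * (L : ℝ)) ≤ ρ) (k : ℕ) : ((L : ℝ)⁻¹) ^ k ≤ ρ ^ k := by
  have hLr : (1 : ℝ) ≤ L := by exact_mod_cast hL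
  have h0 : (0 : ℝ) ≤ (L : ℝ)⁻¹ := inv_nonneg.mpr (by linarith)
  refine pow_le_pow_left₀ h0 (le_trans ?_ hρ) k
  rw [div_eq_mul_inv, mul_inv, ← mul_assoc]
  have : (L : ℝ)⁻¹ = 1 * (L : ℝ)⁻¹ := (one_mul _).symm
  nlinarith [inv_pos.mpr (by linarith : (0 : ℝ) < L)]

/-- `(L⁻¹)^{m} ≤ (L⁻¹)^{k}` for `k ≤ m` (`L ≥ 1`). [folklore] -/
theorem invPow_le_invPow (hL : 1 ≤ L) {k m : ℕ} (hkm : k ≤ m) : ((L : ℝ)⁻¹) ^ m ≤ ((L : ℝ)⁻¹) ^ k := by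
  have hLr : (1 : ℝ) ≤ L := by exact_mod_cast hL
  exact pow_le_pow_of_le_one (inv_nonneg.mpr (by linarith)) (inv_le_one_of_one_le₀ hLr) hkm

/-! ## §2 The sums `Γ` and `E` for print's letter shapes -/

/-- the closed-form bound of the coefficient-letter sum: `Γ_U = 128·d·p_U`. [folklore] -/
def GamU (d : ℕ) (pU : ℝ) : ℝ := 128 * d * pU

/-- the level count `q = (d+1)·L` as a real number. [folklore] -/
def qN (d L : ℕ) : ℝ := (((d + 1) * L : ℕ) : ℝ)

variable (o : Type*) [Fintype o]

/-- the closed-form bound of the primed-step size sum: `E_U = card o·q·2α_U·e^{q·2α_U} + c_R·Γ_U`. [folklore] -/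
def EU (d L : ℕ) (αU pU : ℝ) : ℝ := Fintype.card o * (qN d L * (2 * αU) * Real.exp (qN d L * (2 * αU))) + cR d L o * GamU d pU

variable {o}

/-- `0 ≤ Γ_U`. [folklore] -/
theorem GamU_nonneg {pU : ℝ} (hpU : 0 ≤ pU) : 0 ≤ GamU d pU := by unfold GamU; positivity

/-- `0 ≤ qN`. [folklore] -/
theorem qN_nonneg : 0 ≤ qN d L := Nat.cast_nonneg _

/-- `0 ≤ E_U`. [folklore] -/
theorem EU_nonneg {αU pU : ℝ} (hαU : 0 ≤ αU) (hpU : 0 ≤ pU) : 0 ≤ EU o d L αU pU := by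
  unfold EU; have := cR_nonneg (d := d) L (o := o); have := GamU_nonneg (d := d) hpU; have := qN_nonneg (d := d) (L := L); positivity

/-- one coefficient letter: `64·d·L²·p_{k,i+1} ≤ 64·d·p_U·((L⁻¹)²)^i`. [folklore] -/
theorem gamma_term_le (hL : 1 ≤ L) {p : ℕ → ℕ → ℝ} {pU : ℝ} (hpU : ∀ k i, p k i ≤ pU * ((L : ℝ)⁻¹) ^ (2 * i)) (k i : ℕ) :
    64 * (d * (L : ℝ) ^ 2 * p k (i + 1)) ≤ 64 * d * pU * (((L : ℝ)⁻¹) ^ 2) ^ i := by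
  have hLr : (0 : ℝ) < L := by exact_mod_cast hL
  have h := hpU k (i + 1)
  have e : (L : ℝ) ^ 2 * (pU * ((L : ℝ)⁻¹) ^ (2 * (i + 1))) = pU * (((L : ℝ)⁻¹) ^ 2) ^ i := by
    rw [show 2 * (i + 1) = 2 * i + 2 by ring, pow_add, ← pow_mul]; field_simp
  have hd : (0 : ℝ) ≤ d := Nat.cast_nonneg d
  nlinarith [mul_le_mul_of_nonneg_left h (by positivity : (0 : ℝ) ≤ (L : ℝ) ^ 2)]

/-- **`hΓ` FOR PRINT's PLAQUETTE LETTERS**: `Σ_{i<k′} 64·d·L²·p_{k,i+1} ≤ Γ_U` whenever `p_{k,i} ≤ p_U/L^{2i}`. [cite: Balaban1985Averaging, (143) p.39 (shape)] [folklore] -/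
theorem sum_gamma_le (hL : 2 ≤ L) {p : ℕ → ℕ → ℝ} {pU : ℝ} (hpU0 : 0 ≤ pU) (hpU : ∀ k i, p k i ≤ pU * ((L : ℝ)⁻¹) ^ (2 * i)) (k k' : ℕ) :
    ∑ i ∈ range k', 64 * (d * (L : ℝ) ^ 2 * p k (i + 1)) ≤ GamU d pU := by
  have hd : (0 : ℝ) ≤ d := Nat.cast_nonneg d
  calc ∑ i ∈ range k', 64 * (d * (L : ℝ) ^ 2 * p k (i + 1)) ≤ ∑ i ∈ range k', 64 * d * pU * (((L : ℝ)⁻¹) ^ 2) ^ i :=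
        Finset.sum_le_sum fun i _ => gamma_term_le (by omega) hpU k i
    _ = 64 * d * pU * ∑ i ∈ range k', (((L : ℝ)⁻¹) ^ 2) ^ i := by rw [Finset.mul_sum]
    _ ≤ 64 * d * pU * 2 := mul_le_mul_of_nonneg_left (sum_invSq_le_two hL k') (by positivity)
    _ = GamU d pU := by unfold GamU; ring

/-- one primed-step size letter: `(1 + 2α_U/n_{i+1})^q − 1 ≤ q·2α_U·e^{q·2α_U}·(L⁻¹)^{i+1}`. [folklore] -/
theorem sigma_term_le (hL : 1 ≤ L) {αU : ℝ} (hαU : 0 ≤ αU) (i : ℕ) :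
    (1 + 2 * αU / (lev L (i + 1) : ℕ)) ^ ((d + 1) * L) - 1 ≤ qN d L * (2 * αU) * Real.exp (qN d L * (2 * αU)) * ((L : ℝ)⁻¹) ^ (i + 1) := by
  have hLr : (1 : ℝ) ≤ L := by exact_mod_cast hL
  have h0 : (0 : ℝ) ≤ (L : ℝ)⁻¹ := inv_nonneg.mpr (by linarith)
  have hx1 : ((L : ℝ)⁻¹) ^ (i + 1) ≤ 1 := pow_le_one₀ h0 (inv_le_one_of_one_le₀ hLr)
  have e : 2 * αU / (lev L (i + 1) : ℕ) = 2 * αU * ((L : ℝ)⁻¹) ^ (i + 1) := by rw [div_eq_mul_inv, inv_lev_eq]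
  have hc : 0 ≤ 2 * αU * ((L : ℝ)⁻¹) ^ (i + 1) := by positivity
  have hc₀ : 2 * αU * ((L : ℝ)⁻¹) ^ (i + 1) ≤ 2 * αU := mul_le_of_le_one_right (by positivity) hx1
  have h := deltaS_le (d := d) (L := L) hc hc₀
  unfold deltaS at h
  rw [e]
  calc (1 + 2 * αU * ((L : ℝ)⁻¹) ^ (i + 1)) ^ ((d + 1) * L) - 1 ≤ (((d + 1) * L : ℕ) : ℝ) * (2 * αU * ((L : ℝ)⁻¹) ^ (i + 1)) * Real.exp ((((d + 1) * L : ℕ) : ℝ) * (2 * αU)) := h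
    _ = _ := by unfold qN; ring

/-- **`hE` FOR PRINT's LETTERS**: `Σ_{i<k′} (card o·((1 + 2α_U/n_{i+1})^q − 1) + c_R·64·d·L²·p_{k,i+1}) ≤ E_U`. [cite: Balaban1985Averaging, (143) p.39 (shape)] [folklore] -/
theorem sum_eps_le (hL : 2 ≤ L) {αU pU : ℝ} (hαU : 0 ≤ αU) (hpU0 : 0 ≤ pU) {p : ℕ → ℕ → ℝ}
    (hpU : ∀ k i, p k i ≤ pU * ((L : ℝ)⁻¹) ^ (2 * i)) (k k' : ℕ) :
    ∑ i ∈ range k', (Fintype.card o * ((1 + 2 * αU / (lev L (i + 1) : ℕ)) ^ ((d + 1) * L) - 1) + cR d L o * (64 * (d * (L : ℝ) ^ 2 * p k (i + 1)))) ≤ EU o d L αU pU := by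
  have hcR := cR_nonneg (d := d) L (o := o)
  have hq := qN_nonneg (d := d) (L := L)
  rw [Finset.sum_add_distrib, ← Finset.mul_sum, ← Finset.mul_sum]
  unfold EU
  refine add_le_add (mul_le_mul_of_nonneg_left ?_ (Nat.cast_nonneg _)) (mul_le_mul_of_nonneg_left (sum_gamma_le hL hpU0 hpU k k') hcR)
  calc ∑ i ∈ range k', ((1 + 2 * αU / (lev L (i + 1) : ℕ)) ^ ((d + 1) * L) - 1)
      ≤ ∑ i ∈ range k', qN d L * (2 * αU) * Real.exp (qN d L * (2 * αU)) * ((L : ℝ)⁻¹) ^ (i + 1) := Finset.sum_le_sum fun i _ => sigma_term_le (by omega) hαU i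
    _ = qN d L * (2 * αU) * Real.exp (qN d L * (2 * αU)) * ∑ i ∈ range k', ((L : ℝ)⁻¹) ^ (i + 1) := by rw [Finset.mul_sum]
    _ ≤ qN d L * (2 * αU) * Real.exp (qN d L * (2 * αU)) * 1 := mul_le_mul_of_nonneg_left (sum_invPow_succ_le_one hL k') (by positivity)
    _ = _ := mul_one _


/-! ## §3 The rate inequality `sameBnd + crossBnd ≤ C_r·ρ^k` for print's letter shapes -/

section Rate

variable (o)

/-- the size factor `r₀ = 1 + card o·(e^{q·2α_U} − 1)` of the transport products. [folklore] -/
def rZero (d L : ℕ) (αU : ℝ) : ℝ := 1 + Fintype.card o * (Real.exp ((((d + 1) * L : ℕ) : ℝ) * (2 * αU)) - 1)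

/-- the per-level difference constant `D₁ = card o·2q·e^{q·2σ_U} + c_R·(192·(d+1)L + 64·d·p_U·(2 + 4q·e^{q·2σ_U}))`. [folklore] -/
def DOne (d L : ℕ) (σU pU : ℝ) : ℝ :=
  Fintype.card o * (2 * qN d L * Real.exp (qN d L * (2 * σU))) + cR d L o * (192 * ((d + 1) * L : ℝ) + 64 * d * pU * (2 + 4 * qN d L * Real.exp (qN d L * (2 * σU))))

/-- the same-data rate constant `S₀ = r·(d·C + card o·q·2α_U·e^{q·2α_U}·C) + F·c_R·64·d·p_U·C` (`r = r₀·c_R·Γ_U·e^{E_U}`, `F = r₀ + r`, `C = Cst d a`). [folklore] -/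
def SZero (d L : ℕ) (a αU pU : ℝ) : ℝ :=
  (rZero o d L αU * cR d L o * GamU d pU * Real.exp (EU o d L αU pU)) * (d * Cst d a + Fintype.card o * (qN d L * (2 * αU) * Real.exp (qN d L * (2 * αU))) * Cst d a)
    + (rZero o d L αU + rZero o d L αU * cR d L o * GamU d pU * Real.exp (EU o d L αU pU)) * cR d L o * (64 * d * pU) * Cst d a

/-- the cross rate constant `X₀ = (F·2σ_U·D₁·e^{E_U} + card o·q·2σ_U·e^{q·2σ_U})·C`. [folklore] -/
def XZero (d L : ℕ) (a αU σU pU : ℝ) : ℝ :=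
  ((rZero o d L αU + rZero o d L αU * cR d L o * GamU d pU * Real.exp (EU o d L αU pU)) * (2 * σU * DOne o d L σU pU) * Real.exp (EU o d L αU pU)
    + Fintype.card o * (qN d L * (2 * σU) * Real.exp (qN d L * (2 * σU)))) * Cst d a

/-- **THE CLOSED-FORM RATE CONSTANT `C_r = S₀ + X₀`**. [folklore] -/
def CrU (d L : ℕ) (a αU σU pU : ℝ) : ℝ := SZero o d L a αU pU + XZero o d L a αU σU pU

variable {o}

/-- `1 ≤ r₀`. [folklore] -/
theorem one_le_rZero (αU : ℝ) (hαU : 0 ≤ αU) : 1 ≤ rZero o d L αU := by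
  unfold rZero
  have : (1 : ℝ) ≤ Real.exp ((((d + 1) * L : ℕ) : ℝ) * (2 * αU)) := Real.one_le_exp (by positivity)
  nlinarith [Nat.cast_nonneg (α := ℝ) (Fintype.card o)]

/-- the closeness letter on the chain: `consC k i = σ_Uθ_c^k(L⁻¹)^i` for `i ≤ k`. [folklore] -/
theorem consC_of_le {σU θc : ℝ} {k i : ℕ} (h : i ≤ k) : consC L σU θc k i = σU * θc ^ k * ((L : ℝ)⁻¹) ^ i := by
  unfold consC; rw [if_pos h]

/-- doubling the closeness letter inside `consBal` = the letter with `2σ_U` (only levels `≤ k` are read). [folklore] -/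
theorem consBal_two_consC (σU θc : ℝ) (k : ℕ) : consBal d L (fun i => 2 * consC L σU θc k i) k = consBal d L (consC L (2 * σU) θc k) k := by
  unfold consBal
  congr 1
  refine List.map_congr_left fun i' hi' => ?_
  rw [List.mem_range] at hi'
  simp only [consC_of_le (show i' + 1 ≤ k by omega)]; ring

/-- the composed-table cross letter: `consBal d L (2·consC) k ≤ q·2σ_U·e^{q·2σ_U}·θ_c^k`. [folklore] -/
theorem theta_le (hL : 2 ≤ L) {σU θc : ℝ} (hσU : 0 ≤ σU) (hθ0 : 0 ≤ θc) (hθ1 : θc ≤ 1) (k : ℕ) :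
    consBal d L (fun i => 2 * consC L σU θc k i) k ≤ qN d L * (2 * σU) * Real.exp (qN d L * (2 * σU)) * θc ^ k := by
  rw [consBal_two_consC]; unfold qN
  exact consBal_le (d := d) L hL (by positivity) hθ0 hθ1 k

/-- ONE per-level difference letter of the chain: `Δ_i ≤ D₁·σ_Uθ_c^k(L⁻¹)^i` (`i < k`). [folklore] -/
theorem DeltaStep_le (hL : 2 ≤ L) {σU θc pU : ℝ} (hσU : 0 ≤ σU) (hθ0 : 0 ≤ θc) (hθ1 : θc ≤ 1) (hpU0 : 0 ≤ pU) {p : ℕ → ℕ → ℝ} (hp0 : ∀ k i, 0 ≤ p k i)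
    (hpU : ∀ k i, p k i ≤ pU * ((L : ℝ)⁻¹) ^ (2 * i)) {k i : ℕ} (hik : i < k) :
    DeltaStep d L o (2 * consC L σU θc k (i + 1)) (64 * (d * (L : ℝ) ^ 2 * p k (i + 1))) (192 * ((d + 1) * L) * consC L σU θc k (i + 1)) (2 * consC L σU θc k i)
      ≤ DOne o d L σU pU * (σU * θc ^ k * ((L : ℝ)⁻¹) ^ i) := by
  obtain ⟨h0, h2⟩ := inv_le_half hL
  have hLr : (1 : ℝ) ≤ L := by exact_mod_cast (by omega : 1 ≤ L)
  have hcR := cR_nonneg (d := d) L (o := o)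
  have hq := qN_nonneg (d := d) (L := L)
  have hd : (0 : ℝ) ≤ d := Nat.cast_nonneg d
  set t : ℝ := σU * θc ^ k * ((L : ℝ)⁻¹) ^ i with ht
  have ht0 : 0 ≤ t := by positivity
  have hθk : θc ^ k ≤ 1 := pow_le_one₀ hθ0 hθ1
  have hxi : ((L : ℝ)⁻¹) ^ i ≤ 1 := pow_le_one₀ h0 (by linarith)
  have htσ : t ≤ σU := by
    have : θc ^ k * ((L : ℝ)⁻¹) ^ i ≤ 1 := mul_le_one₀ hθk (pow_nonneg h0 i) hxi
    nlinarith
  have hc1 : consC L σU θc k (i + 1) = t * (L : ℝ)⁻¹ := by rw [consC_of_le (by omega), pow_succ]; ring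
  have hc0 : consC L σU θc k i = t := consC_of_le (by omega)
  have hc1t : consC L σU θc k (i + 1) ≤ t := by rw [hc1]; exact mul_le_of_le_one_right ht0 (by linarith)
  have hc10 : 0 ≤ consC L σU θc k (i + 1) := by rw [hc1]; positivity
  -- the transport-difference letter
  have hdS : deltaS d L (2 * consC L σU θc k (i + 1)) ≤ 2 * qN d L * Real.exp (qN d L * (2 * σU)) * t := by
    have h := deltaS_le (d := d) (L := L) (c := 2 * consC L σU θc k (i + 1)) (c₀ := 2 * σU) (by positivity) (by linarith)
    have hm : (((d + 1) * L : ℕ) : ℝ) * (2 * consC L σU θc k (i + 1)) ≤ (((d + 1) * L : ℕ) : ℝ) * (2 * t) :=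
      mul_le_mul_of_nonneg_left (by linarith) (Nat.cast_nonneg _)
    unfold qN
    calc deltaS d L (2 * consC L σU θc k (i + 1)) ≤ _ := h
      _ ≤ (((d + 1) * L : ℕ) : ℝ) * (2 * t) * Real.exp ((((d + 1) * L : ℕ) : ℝ) * (2 * σU)) := mul_le_mul_of_nonneg_right hm (Real.exp_pos _).le
      _ = _ := by ring
  have hdS0 : 0 ≤ deltaS d L (2 * consC L σU θc k (i + 1)) := deltaS_nonneg (by positivity)
  set Y : ℝ := Real.exp (qN d L * (2 * σU)) with hY
  -- the coefficient letter
  have hg : 64 * (d * (L : ℝ) ^ 2 * p k (i + 1)) ≤ 64 * d * pU := by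
    refine (gamma_term_le (by omega) hpU k i).trans ?_
    have : (((L : ℝ)⁻¹) ^ 2) ^ i ≤ 1 := pow_le_one₀ (pow_nonneg h0 2) (by nlinarith)
    exact mul_le_of_le_one_right (by positivity) this
  have hg0 : 0 ≤ 64 * (d * (L : ℝ) ^ 2 * p k (i + 1)) := by have := hp0 k (i + 1); positivity
  -- assemble
  have hY1 : 0 ≤ Y := (Real.exp_pos _).le
  have h1 : (Fintype.card o : ℝ) * deltaS d L (2 * consC L σU θc k (i + 1)) ≤ Fintype.card o * (2 * qN d L * Y) * t := by
    have := mul_le_mul_of_nonneg_left hdS (Nat.cast_nonneg (α := ℝ) (Fintype.card o)); linarith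
  have h2 : 192 * ((d + 1) * L) * consC L σU θc k (i + 1) ≤ 192 * ((d + 1) * L : ℝ) * t := mul_le_mul_of_nonneg_left hc1t (by positivity)
  have h3 : 64 * (d * (L : ℝ) ^ 2 * p k (i + 1)) * (2 * t + 2 * deltaS d L (2 * consC L σU θc k (i + 1))) ≤ 64 * d * pU * (2 + 4 * qN d L * Y) * t := by
    have hin : 2 * t + 2 * deltaS d L (2 * consC L σU θc k (i + 1)) ≤ (2 + 4 * qN d L * Y) * t := by nlinarith
    calc 64 * (d * (L : ℝ) ^ 2 * p k (i + 1)) * (2 * t + 2 * deltaS d L (2 * consC L σU θc k (i + 1)))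
        ≤ (64 * d * pU) * ((2 + 4 * qN d L * Y) * t) := mul_le_mul hg hin (by positivity) (by positivity)
      _ = _ := by ring
  unfold DeltaStep DOne
  rw [← hY, hc0]
  nlinarith [mul_le_mul_of_nonneg_left (add_le_add h2 h3) hcR]

/-- the SUM of the per-level difference letters: `Σ_{i<k} Δ_i ≤ 2σ_U·D₁·θ_c^k`. [folklore] -/
theorem Dsum_le (hL : 2 ≤ L) {σU θc pU : ℝ} (hσU : 0 ≤ σU) (hθ0 : 0 ≤ θc) (hθ1 : θc ≤ 1) (hpU0 : 0 ≤ pU) {p : ℕ → ℕ → ℝ} (hp0 : ∀ k i, 0 ≤ p k i)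
    (hpU : ∀ k i, p k i ≤ pU * ((L : ℝ)⁻¹) ^ (2 * i)) (k : ℕ) :
    ∑ i ∈ range k, DeltaStep d L o (2 * consC L σU θc k (i + 1)) (64 * (d * (L : ℝ) ^ 2 * p k (i + 1))) (192 * ((d + 1) * L) * consC L σU θc k (i + 1)) (2 * consC L σU θc k i)
      ≤ 2 * σU * DOne o d L σU pU * θc ^ k := by
  have hD : 0 ≤ DOne o d L σU pU := by
    unfold DOne; have := cR_nonneg (d := d) L (o := o); have := qN_nonneg (d := d) (L := L); positivity
  calc ∑ i ∈ range k, DeltaStep d L o (2 * consC L σU θc k (i + 1)) (64 * (d * (L : ℝ) ^ 2 * p k (i + 1))) (192 * ((d + 1) * L) * consC L σU θc k (i + 1)) (2 * consC L σU θc k i)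
      ≤ ∑ i ∈ range k, DOne o d L σU pU * (σU * θc ^ k * ((L : ℝ)⁻¹) ^ i) :=
        Finset.sum_le_sum fun i hi => DeltaStep_le hL hσU hθ0 hθ1 hpU0 hp0 hpU (Finset.mem_range.mp hi)
    _ = DOne o d L σU pU * (σU * θc ^ k) * ∑ i ∈ range k, ((L : ℝ)⁻¹) ^ i := by rw [Finset.mul_sum]; exact Finset.sum_congr rfl fun i _ => by ring
    _ ≤ DOne o d L σU pU * (σU * θc ^ k) * 2 := mul_le_mul_of_nonneg_left (sum_invPow_le_two hL k) (by positivity)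
    _ = _ := by ring

/-- the PRODUCT of the primed step sizes: `Π_{i<k}(1 + ε_i) ≤ e^{E_U}`. [folklore] -/
theorem P_le (hL : 2 ≤ L) {αU pU : ℝ} (hαU : 0 ≤ αU) (hpU0 : 0 ≤ pU) {p : ℕ → ℕ → ℝ} (hp0 : ∀ k i, 0 ≤ p k i)
    (hpU : ∀ k i, p k i ≤ pU * ((L : ℝ)⁻¹) ^ (2 * i)) (k k₁ : ℕ) :
    ∏ i ∈ range k, (1 + epsStep d L o ((1 + 2 * αU / (lev L (i + 1) : ℕ)) ^ ((d + 1) * L) - 1) (64 * (d * (L : ℝ) ^ 2 * p k₁ (i + 1))))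
      ≤ Real.exp (EU o d L αU pU) := by
  have hcR := cR_nonneg (d := d) L (o := o)
  have hx : ∀ i, 0 ≤ epsStep d L o ((1 + 2 * αU / (lev L (i + 1) : ℕ)) ^ ((d + 1) * L) - 1) (64 * (d * (L : ℝ) ^ 2 * p k₁ (i + 1))) := fun i => by
    unfold epsStep
    have h1 : (0 : ℝ) ≤ (1 + 2 * αU / (lev L (i + 1) : ℕ)) ^ ((d + 1) * L) - 1 := sub_nonneg.mpr (one_le_pow₀ (le_add_of_nonneg_right (by positivity)))
    have := hp0 k₁ (i + 1); positivity
  refine (prod_one_add_le_exp_sum _ hx k).trans (Real.exp_le_exp.mpr ?_)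
  unfold epsStep
  exact sum_eps_le hL hαU hpU0 hpU k₁ k


/-- each per-level difference letter is `≥ 0`. [folklore] -/
theorem DeltaStep_nonneg {σU θc : ℝ} (hσU : 0 ≤ σU) (hθ0 : 0 ≤ θc) {p : ℕ → ℕ → ℝ} (hp0 : ∀ k i, 0 ≤ p k i) (k i : ℕ) :
    0 ≤ DeltaStep d L o (2 * consC L σU θc k (i + 1)) (64 * (d * (L : ℝ) ^ 2 * p k (i + 1))) (192 * ((d + 1) * L) * consC L σU θc k (i + 1)) (2 * consC L σU θc k i) := by
  have hcR := cR_nonneg (d := d) L (o := o)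
  have h1 := consC_nonneg L hσU hθ0 k (i + 1)
  have h0 := consC_nonneg L hσU hθ0 k i
  have hdS : 0 ≤ deltaS d L (2 * consC L σU θc k (i + 1)) := deltaS_nonneg (by positivity)
  have := hp0 k (i + 1)
  unfold DeltaStep; positivity

/-- **THE RATE INEQUALITY FOR PRINT's LETTER SHAPES**: file 7's `hrate` with `Γ := Γ_U`, `E := E_U`, `c_U := consC L σ_U θ_c`, plaquette letters dominated by `p_U/L^{2i}`, holds with
`C_r := CrU` for every `ρ ≥ max(θ_c, 3/(2L))` — the same-data part decays like `L^{−k}` (top-step size `O(α_UL^{−k})`, top coefficient `O(p_UL^{−2k})`, King's `n_k⁻¹ = L^{−k}`), the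
cross part like `θ_c^k`. [cite: Balaban1985Averaging, (143) p.39 (shape); King1986, Lemma 4.5 (4.38) p.674 (method)] [folklore] -/
theorem rate_le (hL : 2 ≤ L) (a : ℝ) {αU σU θc ρ pU : ℝ} (hαU : 0 ≤ αU) (hσU : 0 ≤ σU) (hθ0 : 0 ≤ θc) (hθ1 : θc ≤ 1) (hθρ : θc ≤ ρ)
    (hρ : 3 / (2 * (L : ℝ)) ≤ ρ) (hpU0 : 0 ≤ pU) {p : ℕ → ℕ → ℝ} (hp0 : ∀ k i, 0 ≤ p k i) (hpU : ∀ k i, p k i ≤ pU * ((L : ℝ)⁻¹) ^ (2 * i)) (k : ℕ) :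
    sameBnd d L o (Cst d a) ((1 + Fintype.card o * (Real.exp ((((d + 1) * L : ℕ) : ℝ) * (2 * αU)) - 1)) * cR d L o * GamU d pU * Real.exp (EU o d L αU pU))
        (1 + Fintype.card o * (Real.exp ((((d + 1) * L : ℕ) : ℝ) * (2 * αU)) - 1)
          + (1 + Fintype.card o * (Real.exp ((((d + 1) * L : ℕ) : ℝ) * (2 * αU)) - 1)) * cR d L o * GamU d pU * Real.exp (EU o d L αU pU))
        ((1 + 2 * αU / (lev L (k + 1) : ℕ)) ^ ((d + 1) * L) - 1) (64 * (d * (L : ℝ) ^ 2 * p (k + 1) (k + 1))) (lev L k)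
      + crossBnd o (Cst d a) (1 + Fintype.card o * (Real.exp ((((d + 1) * L : ℕ) : ℝ) * (2 * αU)) - 1)
          + (1 + Fintype.card o * (Real.exp ((((d + 1) * L : ℕ) : ℝ) * (2 * αU)) - 1)) * cR d L o * GamU d pU * Real.exp (EU o d L αU pU))
        (∑ i ∈ range k, DeltaStep d L o (2 * consC L σU θc k (i + 1)) (64 * (d * (L : ℝ) ^ 2 * p k (i + 1))) (192 * ((d + 1) * L) * consC L σU θc k (i + 1)) (2 * consC L σU θc k i))
        (∏ i ∈ range k, (1 + epsStep d L o ((1 + 2 * αU / (lev L (i + 1) : ℕ)) ^ ((d + 1) * L) - 1) (64 * (d * (L : ℝ) ^ 2 * p (k + 1) (i + 1)))))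
        (consBal d L (fun i => 2 * consC L σU θc k i) k)
      ≤ CrU o d L a αU σU pU * ρ ^ k := by
  obtain ⟨h0, h2⟩ := inv_le_half hL
  have hL1 : 1 ≤ L := by omega
  have hLr : (1 : ℝ) ≤ L := by exact_mod_cast hL1
  have hcR := cR_nonneg (d := d) L (o := o)
  have hCs := Cst_nonneg d a
  have hq := qN_nonneg (d := d) (L := L)
  have hd : (0 : ℝ) ≤ d := Nat.cast_nonneg d
  have hco : (0 : ℝ) ≤ Fintype.card o := Nat.cast_nonneg _
  have hG := GamU_nonneg (d := d) hpU0
  have hρ0 : 0 ≤ ρ := hθ0.trans hθρ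
  have hρk : ((L : ℝ)⁻¹) ^ k ≤ ρ ^ k := invPow_le_rhoPow hL1 hρ k
  have hθk : θc ^ k ≤ ρ ^ k := pow_le_pow_left₀ hθ0 hθρ k
  -- the size factor `r₀ ≥ 1`
  set r0 : ℝ := 1 + Fintype.card o * (Real.exp ((((d + 1) * L : ℕ) : ℝ) * (2 * αU)) - 1) with hr0
  have hr0' : 1 ≤ r0 := one_le_rZero (o := o) (d := d) (L := L) αU hαU
  have hr00 : 0 ≤ r0 := by linarith
  set r : ℝ := r0 * cR d L o * GamU d pU * Real.exp (EU o d L αU pU) with hr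
  have hr_0 : 0 ≤ r := by positivity
  have hF0 : 0 ≤ r0 + r := by positivity
  -- (i) King's `1/n_k`
  have hn : (d : ℝ) * Cst d a / (lev L k : ℕ) = d * Cst d a * ((L : ℝ)⁻¹) ^ k := by rw [div_eq_mul_inv, inv_lev_eq]
  -- (ii) the top-step size
  have hσt : (1 + 2 * αU / (lev L (k + 1) : ℕ)) ^ ((d + 1) * L) - 1 ≤ qN d L * (2 * αU) * Real.exp (qN d L * (2 * αU)) * ρ ^ k := by
    refine (sigma_term_le (d := d) hL1 hαU k).trans (mul_le_mul_of_nonneg_left ((invPow_le_invPow hL1 (Nat.le_succ k)).trans hρk) (by positivity))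
  -- (iii) the top coefficient letter
  have hγt : 64 * (d * (L : ℝ) ^ 2 * p (k + 1) (k + 1)) ≤ 64 * d * pU * ρ ^ k := by
    refine (gamma_term_le (d := d) hL1 hpU (k + 1) k).trans (mul_le_mul_of_nonneg_left ?_ (by positivity))
    have hsq : ((L : ℝ)⁻¹) ^ 2 ≤ (L : ℝ)⁻¹ := by nlinarith
    exact (pow_le_pow_left₀ (pow_nonneg h0 2) hsq k).trans hρk
  -- (iv) the cross difference sum, (v) the product, (vi) the table letter
  have hD := Dsum_le (o := o) (d := d) hL hσU hθ0 hθ1 hpU0 hp0 hpU k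
  have hD1 : 0 ≤ DOne o d L σU pU := by unfold DOne; positivity
  have hDρ : 2 * σU * DOne o d L σU pU * θc ^ k ≤ 2 * σU * DOne o d L σU pU * ρ ^ k := mul_le_mul_of_nonneg_left hθk (by positivity)
  have hDsum0 : 0 ≤ ∑ i ∈ range k, DeltaStep d L o (2 * consC L σU θc k (i + 1)) (64 * (d * (L : ℝ) ^ 2 * p k (i + 1))) (192 * ((d + 1) * L) * consC L σU θc k (i + 1)) (2 * consC L σU θc k i) :=
    Finset.sum_nonneg fun i _ => DeltaStep_nonneg (o := o) (d := d) hσU hθ0 hp0 k i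
  have hP := P_le (o := o) (d := d) hL hαU hpU0 hp0 hpU k (k + 1)
  have hP0 : 0 ≤ ∏ i ∈ range k, (1 + epsStep d L o ((1 + 2 * αU / (lev L (i + 1) : ℕ)) ^ ((d + 1) * L) - 1) (64 * (d * (L : ℝ) ^ 2 * p (k + 1) (i + 1)))) :=
    Finset.prod_nonneg fun i _ => by
      have h1 : (0 : ℝ) ≤ (1 + 2 * αU / (lev L (i + 1) : ℕ)) ^ ((d + 1) * L) - 1 := sub_nonneg.mpr (one_le_pow₀ (le_add_of_nonneg_right (by positivity)))
      have := hp0 (k + 1) (i + 1); unfold epsStep; positivity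
  have hθ := theta_le (d := d) hL hσU hθ0 hθ1 k
  have hθρ' : qN d L * (2 * σU) * Real.exp (qN d L * (2 * σU)) * θc ^ k ≤ qN d L * (2 * σU) * Real.exp (qN d L * (2 * σU)) * ρ ^ k :=
    mul_le_mul_of_nonneg_left hθk (by positivity)
  -- assemble
  unfold sameBnd crossBnd
  rw [hn]
  calc r * (d * Cst d a * ((L : ℝ)⁻¹) ^ k + Fintype.card o * ((1 + 2 * αU / (lev L (k + 1) : ℕ)) ^ ((d + 1) * L) - 1) * Cst d a) + (r0 + r) * (cR d L o * (64 * (d * (L : ℝ) ^ 2 * p (k + 1) (k + 1)))) * Cst d a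
        + ((r0 + r) * (∑ i ∈ range k, DeltaStep d L o (2 * consC L σU θc k (i + 1)) (64 * (d * (L : ℝ) ^ 2 * p k (i + 1))) (192 * ((d + 1) * L) * consC L σU θc k (i + 1)) (2 * consC L σU θc k i))
            * (∏ i ∈ range k, (1 + epsStep d L o ((1 + 2 * αU / (lev L (i + 1) : ℕ)) ^ ((d + 1) * L) - 1) (64 * (d * (L : ℝ) ^ 2 * p (k + 1) (i + 1)))))
            + Fintype.card o * consBal d L (fun i => 2 * consC L σU θc k i) k) * Cst d a
      ≤ r * (d * Cst d a * ρ ^ k + Fintype.card o * (qN d L * (2 * αU) * Real.exp (qN d L * (2 * αU)) * ρ ^ k) * Cst d a) + (r0 + r) * (cR d L o * (64 * d * pU * ρ ^ k)) * Cst d a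
        + ((r0 + r) * (2 * σU * DOne o d L σU pU * ρ ^ k) * Real.exp (EU o d L αU pU)
            + Fintype.card o * (qN d L * (2 * σU) * Real.exp (qN d L * (2 * σU)) * ρ ^ k)) * Cst d a := by
        gcongr <;> first | exact hD.trans hDρ | exact hθ.trans hθρ'
    _ = CrU o d L a αU σU pU * ρ ^ k := by
        unfold CrU SZero XZero rZero
        rw [← hr0, ← hr]
        ring

end Rate

end Summit.QuantumFields.BalabanUV.T4Continuum.NE2.ComposedRemainderRateLetters

end
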